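import Mathlib
import HarnessLib
import Summits.HubbardSuperconductivity.HubbardSuperconductivity.Theorems.KLProgrammeKLRegimeEngineTowerLevNumericsDoors

/-!
# Route `KLProgramme` — crux K3 ENGINE (stmt-HubbardSuperconductivity-20437 `KLRegimeEngineV17F2`), stub (b) v2, THE WEIGHTED HALF «(b)-WT4», numerics side
# «part 4» (c) (cell gate-hubbard-kl, seat p4 g22): REDUCED BOUNDS FOR THE WEIGHTED TOWER's (I5) CHOICES — base floor `q₀`, pinned imports, sharp read-out

The weighted assembly W10 (`kernelNormsWt4_all_klEng_structural`, k3c3-p2 g17, p703207) PINS the main tower's imports `ι₁ = i₁(M/β)`, `ι₂ = i₂(M/β)³`,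
`ι₃ = x₆(M/β)⁵` (no `1/B` available) and leaves the law constants `A Q′`, the profile `A′ Q″` (four dominations) and `B` to the numerics.  The numerics take
the tree's GENERIC (I5) choices (…TowerLevNumericsG: `Q″ = Z·Qb + q₀ + 1`, `Q′ = max 4 (2τψ)·Q″`, `a = W·Ab + κ_A·Ab`, `Y = ι₂/(2Q″) + WZ³X/(4Q″²) + aQ″/2`,
`A = 2Y(1−2^{−d})/(κ_A Q″)`, `A′ = a + 2Y/Q″`) with `X := ι₃/(WZ³)` and a BASE FLOOR `q₀ = q₀₀·(M/β)²` that absorbs the pinned imports (the λ-free part of `Y`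
is shrunk by `q₀₀`, the base-amplitude part by `B`: `Ab = ab·(β/M)/B²`).  On the reduced variable `r := β/M` (`σ = s₀r²`, `τ = t₀r²`, `ψ = p₀/r²`, `Φ = φ₀/r`;
`W, Z` constants) this file proves: `levNumW_Q'_bounds` (`q₀₀/r² ≤ Q″ ≤ (Z·qb + q₀₀ + 1)/r²`), `levNumW_Y_bounds` (`yL/r ≤ Y ≤ yP/r`), `levNumW_A'_bounds`,
the SHARP read-out row bounds `levNumW_Atot_le` (`Atot = C₁r/C₂r·(Ab + A) + Cinc·(A′x₁/(1−x₁) + e(τS)(Φ(τS)/(1−Φ(τS)))/(2τQ″)) ≤ aT·r`) and `levNumW_Qtot_le`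
(`Qro = C₂r²·max Q′ Qb`), the MONOTONICITY of the y/θ/close kit rows in `ι₃` (`levNumW_rows_mono`, reconciling NumericsG's `ι₃ᴳ = WZ³X + A′Q″³ ≥ ι₃` with W10's
pinned `ι₃`), the BLOCKING conversion `levNumW_block`, and the amplitude bookkeeping `levNumW_yP_small` (`q₀₀ := 1 + (i₂ + x₆)·K`, `B ≥ (W + κ_A)·ab·QH·K`
⇒ `yP·K ≤ 1`).  Pure real arithmetic; nothing about the model is asserted; nothing asserts (b), WT4, (ℓ), any stub, K3 or superconductivity.
References: BGM 2006 §2.8 (2.83)–(2.84), (2.93)–(2.98), Lemma 2.5 (2.98) [cite: BenfattoGiulianiMastropietro2006].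
-/

noncomputable section

namespace Summit.HubbardSuperconductivity.HubbardSuperconductivity.Theorems.EngineV8

set_option linter.dupNamespace false -- summit = problem name (single-conjunct summit), D-0017

open Real

section BoundsW

variable {r s₀ t₀ p₀ φ₀ σ τ ψ Φ W Z κA Qb qb q₀ q₀₀ Q' Q QL QH Ab ab B a₁ a₂ a X Y A A' ι₁ ι₂ ι₃ ι₃' i₁ i₂ x₆ yP yL aP aA lam sC : ℝ} {d : ℕ}

/-- **`Q″` two-sided** for the (I5)-G base with a floor: `Q″ = Z·Qb + q₀ + 1`, `q₀ = q₀₀/r²`, `0 ≤ Qb ≤ qb/r²`, `0 < r ≤ 1`, `Z, q₀₀ ≥ 0` give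
`q₀₀/r² ≤ Q″`, `1 ≤ Q″`, `Q″ ≤ (Z·qb + q₀₀ + 1)/r²`. [folklore] -/
theorem levNumW_Q'_bounds (hr : 0 < r) (hr1 : r ≤ 1) (hZ : 0 ≤ Z) (hQb0 : 0 ≤ Qb) (hQb : Qb ≤ qb / r ^ 2) (hq₀₀ : 0 ≤ q₀₀) (hq₀ : q₀ = q₀₀ / r ^ 2)
    (hQ' : Q' = Z * Qb + q₀ + 1) : q₀₀ / r ^ 2 ≤ Q' ∧ 1 ≤ Q' ∧ Q' ≤ (Z * qb + q₀₀ + 1) / r ^ 2 := by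
  have hr2 : 0 < r ^ 2 := by positivity
  have hZQ : 0 ≤ Z * Qb := by positivity
  have h1 : (1 : ℝ) ≤ 1 / r ^ 2 := by rw [le_div_iff₀ hr2, one_mul]; exact pow_le_one₀ hr.le hr1
  refine ⟨by rw [hQ', hq₀]; linarith, by rw [hQ', hq₀]; linarith [div_nonneg hq₀₀ hr2.le], ?_⟩
  rw [hQ', hq₀, add_div, add_div, mul_div_assoc]
  have h2 : Z * Qb ≤ Z * (qb / r ^ 2) := mul_le_mul_of_nonneg_left hQb hZ
  linarith

/-- **`Y` two-sided** for the (I5)-G size with `X := ι₃/(WZ³)`: `Y = ι₂/(2Q″) + WZ³X/(4Q″²) + aQ″/2`, `a = a₁ + κ_A a₂`, `a₁ = W·Ab`, `a₂ = Ab`, `Ab = ab·r/B²`,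
`0 ≤ ι₂ ≤ i₂/r³`, `0 ≤ ι₃ ≤ x₆/r⁵`, `QL/r² ≤ Q″ ≤ QH/r²` (`QL > 0`), `1 ≤ B` give
`(W + κ_A)·ab·QL/(2B²)/r ≤ Y ≤ (i₂/(2QL) + x₆/(4QL²) + (W + κ_A)·ab·QH/(2B²))/r`. [folklore] -/
theorem levNumW_Y_bounds (hr : 0 < r) (hW : 0 < W) (hZ : 0 < Z) (hκA : 0 ≤ κA) (hab : 0 ≤ ab) (hB : 1 ≤ B) (hQL : 0 < QL)
    (hQ'₁ : QL / r ^ 2 ≤ Q') (hQ'₂ : Q' ≤ QH / r ^ 2) (hι₂0 : 0 ≤ ι₂) (hι₂ : ι₂ ≤ i₂ / r ^ 3) (hι₃0 : 0 ≤ ι₃) (hι₃ : ι₃ ≤ x₆ / r ^ 5)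
    (hX : X = ι₃ / (W * Z ^ 3)) (hAb : Ab = ab * r / B ^ 2) (ha₁ : a₁ = W * Ab) (ha₂ : a₂ = Ab) (ha : a = a₁ + κA * a₂)
    (hY : Y = ι₂ / (2 * Q') + W * Z ^ 3 * X / (4 * Q' ^ 2) + a * Q' / 2) :
    (W + κA) * ab * QL / (2 * B ^ 2) / r ≤ Y ∧ Y ≤ (i₂ / (2 * QL) + x₆ / (4 * QL ^ 2) + (W + κA) * ab * QH / (2 * B ^ 2)) / r := by
  have hB0 : 0 < B := by linarith
  have hQ'0 : 0 < Q' := lt_of_lt_of_le (by positivity) hQ'₁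
  have hr2 : 0 < r ^ 2 := by positivity
  have hQr : QL ≤ Q' * r ^ 2 := (div_le_iff₀ hr2).1 hQ'₁
  have hQr' : Q' * r ^ 2 ≤ QH := (le_div_iff₀ hr2).1 hQ'₂
  have hWZX : W * Z ^ 3 * X = ι₃ := by rw [hX]; field_simp
  have haeq : a = (W + κA) * ab * r / B ^ 2 := by rw [ha, ha₁, ha₂, hAb]; ring
  have hWκ : 0 ≤ (W + κA) * ab := by positivity
  -- term 1
  have h1 : ι₂ / (2 * Q') ≤ i₂ / (2 * QL) / r := by
    rw [div_div, div_le_div_iff₀ (by positivity) (by positivity)]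
    have hι₂r : ι₂ * r ^ 3 ≤ i₂ := (le_div_iff₀ (by positivity)).1 hι₂
    calc ι₂ * (2 * QL * r) ≤ ι₂ * (2 * (Q' * r ^ 2) * r) := by gcongr
      _ = ι₂ * r ^ 3 * (2 * Q') := by ring
      _ ≤ i₂ * (2 * Q') := by gcongr
  -- term 2
  have h2 : W * Z ^ 3 * X / (4 * Q' ^ 2) ≤ x₆ / (4 * QL ^ 2) / r := by
    rw [hWZX]
    have hQL2 : QL ^ 2 ≤ (Q' * r ^ 2) ^ 2 := pow_le_pow_left₀ hQL.le hQr 2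
    have hι₃r : ι₃ * r ^ 5 ≤ x₆ := (le_div_iff₀ (by positivity)).1 hι₃
    rw [div_div, div_le_div_iff₀ (by positivity) (by positivity)]
    calc ι₃ * (4 * QL ^ 2 * r) ≤ ι₃ * (4 * (Q' * r ^ 2) ^ 2 * r) := by gcongr
      _ = ι₃ * r ^ 5 * (4 * Q' ^ 2) := by ring
      _ ≤ x₆ * (4 * Q' ^ 2) := by gcongr
  -- term 3, both sides
  have h3 : a * Q' / 2 ≤ (W + κA) * ab * QH / (2 * B ^ 2) / r := by
    rw [haeq, div_div, div_le_div_iff₀ (by positivity) (by positivity)]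
    calc (W + κA) * ab * r / B ^ 2 * Q' * (2 * B ^ 2 * r) = (W + κA) * ab * (Q' * r ^ 2) * 2 := by field_simp
      _ ≤ (W + κA) * ab * QH * 2 := by gcongr
  have h3' : (W + κA) * ab * QL / (2 * B ^ 2) / r ≤ a * Q' / 2 := by
    rw [haeq, div_div, div_le_div_iff₀ (by positivity) (by positivity)]
    calc (W + κA) * ab * QL * 2 ≤ (W + κA) * ab * (Q' * r ^ 2) * 2 := by gcongr
      _ = (W + κA) * ab * r / B ^ 2 * Q' * (2 * B ^ 2 * r) := by field_simp
  have h12 : 0 ≤ ι₂ / (2 * Q') + W * Z ^ 3 * X / (4 * Q' ^ 2) := by rw [hWZX]; positivity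
  refine ⟨by rw [hY]; linarith, ?_⟩
  rw [hY, add_div, add_div]
  exact add_le_add (add_le_add h1 h2) h3

/-- **`A′` from above** for the (I5)-G profile: `A′ = a + 2Y/Q″`, `a = (W + κ_A)·ab·r/B²` (pins as above), `0 ≤ Y ≤ yP/r`, `QL/r² ≤ Q″` give
`0 ≤ A′ ≤ ((W + κ_A)·ab/B² + 2yP/QL)·r`. [folklore] -/
theorem levNumW_A'_bounds (hr : 0 < r) (hW : 0 < W) (hκA : 0 ≤ κA) (hab : 0 ≤ ab) (hB : 1 ≤ B) (hQL : 0 < QL) (hY0 : 0 ≤ Y) (hY₂ : Y ≤ yP / r)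
    (hQ'₁ : QL / r ^ 2 ≤ Q') (hAb : Ab = ab * r / B ^ 2) (ha₁ : a₁ = W * Ab) (ha₂ : a₂ = Ab) (ha : a = a₁ + κA * a₂) (hA' : A' = a + 2 * Y / Q') :
    0 ≤ A' ∧ A' ≤ ((W + κA) * ab / B ^ 2 + 2 * yP / QL) * r := by
  have hB0 : 0 < B := by linarith
  have hQ'0 : 0 < Q' := lt_of_lt_of_le (by positivity) hQ'₁
  have haeq : a = (W + κA) * ab * r / B ^ 2 := by rw [ha, ha₁, ha₂, hAb]; ring
  refine ⟨by rw [hA', haeq]; positivity, ?_⟩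
  have hYr' : Y * r ≤ yP := (le_div_iff₀ hr).1 hY₂
  have hyP : 0 ≤ yP := le_trans (by positivity : 0 ≤ Y * r) hYr'
  have hQr : QL ≤ Q' * r ^ 2 := (div_le_iff₀ (by positivity)).1 hQ'₁
  have h2 : 2 * Y / Q' ≤ 2 * yP / QL * r := by
    rw [div_le_iff₀ hQ'0]
    calc 2 * Y = 2 * (Y * r) * QL / (QL * r) := by field_simp
      _ ≤ 2 * yP * (Q' * r ^ 2) / (QL * r) := by gcongr
      _ = 2 * yP / QL * r * Q' := by field_simp
  rw [hA', haeq]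
  have h1 : (W + κA) * ab * r / B ^ 2 = (W + κA) * ab / B ^ 2 * r := by ring
  calc (W + κA) * ab * r / B ^ 2 + 2 * Y / Q' ≤ (W + κA) * ab / B ^ 2 * r + 2 * yP / QL * r := by rw [h1]; linarith
    _ = ((W + κA) * ab / B ^ 2 + 2 * yP / QL) * r := by ring

end BoundsW

/-! ## The SHARP read-out row (anticipating W7b♯: `readoutBracket_le_law_mul_sharp`) -/

section ReadoutW

variable {r t₀ p₀ σ τ ψ Φ Q' Q QL QH Qb qb ρ lam ι₁ i₁ A A' aA aP Ab ab B C₁r C₂r Cinc Dinc Aro Qro Qtot Atot sC S : ℝ}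

/-- **The sharp weighted amplitude `Atot ≤ aT·r`**: from `x₁ ≤ 1/2`, `y = Φ(τS) ≤ 1/2`, `0 ≤ S ≤ (i₁ + sC)/r`, `QL/r² ≤ Q″`, `A ≤ aA·r`, `0 ≤ A′ ≤ aP·r`,
`Ab = ab·r/B²`, `Aro = C₁r/C₂r·(Ab + A)`:
`Atot = Aro + Cinc·(A′·x₁/(1−x₁) + e·(τS)·(Φ(τS)/(1−Φ(τS)))/(2τQ″)) ≤ (C₁r/C₂r·(ab/B² + aA) + Cinc·(aP + e·(i₁ + sC)/(2QL)))·r`.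
[cite: BenfattoGiulianiMastropietro2006, §2.8 (2.93)-(2.98)] -/
theorem levNumW_Atot_le (hr : 0 < r) (hτ0 : 0 < τ) (hQL : 0 < QL) (hQ'₁ : QL / r ^ 2 ≤ Q') (hS0 : 0 ≤ S) (hS' : S ≤ (i₁ + sC) / r)
    (hx₁ : 4 * σ * lam * Q' ≤ 1 / 2) (hy : Φ * (τ * S) ≤ 1 / 2)
    (hA : A ≤ aA * r) (hA'0 : 0 ≤ A') (hA' : A' ≤ aP * r) (hAb : Ab = ab * r / B ^ 2)
    (hC₁r : 0 ≤ C₁r) (hC₂r : 0 < C₂r) (hCinc : 0 ≤ Cinc) (hAro : Aro = C₁r / C₂r * (Ab + A))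
    (hAtot : Atot = Aro + Cinc * (A' * (4 * σ * lam * Q' / (1 - 4 * σ * lam * Q')) +
      exp 1 * (τ * S) * (Φ * (τ * S) / (1 - Φ * (τ * S))) / (2 * τ * Q'))) :
    Atot ≤ (C₁r / C₂r * (ab / B ^ 2 + aA) + Cinc * (aP + exp 1 * (i₁ + sC) / (2 * QL))) * r := by
  have hQ'0 : 0 < Q' := lt_of_lt_of_le (by positivity) hQ'₁
  have hQr : QL ≤ Q' * r ^ 2 := (div_le_iff₀ (by positivity)).1 hQ'₁
  have hSr : S * r ≤ i₁ + sC := (le_div_iff₀ hr).1 hS'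
  have hisC : 0 ≤ i₁ + sC := le_trans (by positivity) hSr
  have hgeo₁ : A' * (4 * σ * lam * Q' / (1 - 4 * σ * lam * Q')) ≤ aP * r :=
    (mul_le_of_le_one_right hA'0 (levNum_geom_le_one hx₁)).trans hA'
  have hgeo₂ : exp 1 * (τ * S) * (Φ * (τ * S) / (1 - Φ * (τ * S))) / (2 * τ * Q') ≤ exp 1 * (i₁ + sC) / (2 * QL) * r := by
    have h1 : exp 1 * (τ * S) * (Φ * (τ * S) / (1 - Φ * (τ * S))) ≤ exp 1 * (τ * S) :=
      mul_le_of_le_one_right (by positivity) (levNum_geom_le_one hy)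
    calc exp 1 * (τ * S) * (Φ * (τ * S) / (1 - Φ * (τ * S))) / (2 * τ * Q') ≤ exp 1 * (τ * S) / (2 * τ * Q') :=
          div_le_div_of_nonneg_right h1 (by positivity)
      _ = exp 1 * (S * r) * QL / (QL * r) / (2 * Q') := by field_simp
      _ ≤ exp 1 * (i₁ + sC) * (Q' * r ^ 2) / (QL * r) / (2 * Q') := by gcongr
      _ = exp 1 * (i₁ + sC) / (2 * QL) * r := by field_simp
  have hAro' : Aro ≤ C₁r / C₂r * (ab / B ^ 2 + aA) * r := by
    rw [hAro, hAb]
    have h1 : C₁r / C₂r * (ab * r / B ^ 2 + A) ≤ C₁r / C₂r * (ab * r / B ^ 2 + aA * r) := by gcongr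
    calc C₁r / C₂r * (ab * r / B ^ 2 + A) ≤ C₁r / C₂r * (ab * r / B ^ 2 + aA * r) := h1
      _ = C₁r / C₂r * (ab / B ^ 2 + aA) * r := by ring
  have h2 : A' * (4 * σ * lam * Q' / (1 - 4 * σ * lam * Q')) + exp 1 * (τ * S) * (Φ * (τ * S) / (1 - Φ * (τ * S))) / (2 * τ * Q') ≤
      (aP + exp 1 * (i₁ + sC) / (2 * QL)) * r := by linarith
  have h3 := mul_le_mul_of_nonneg_left h2 hCinc
  rw [hAtot]; linarith

/-- **The sharp weighted per-leg-pair constant**: `Qro = C₂r²·max Q′ Qb`, `Q′ = ρ·Q″` (`ρ > 0`), `Qtot = Dinc·max 1 (max Qro (max (4Q″) (2τψQ″)))`, `τ = t₀r²`,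
`ψ = p₀/r²`, `0 < Q″ ≤ QH/r²`, `0 ≤ Qb ≤ qb/r²`, `1 ≤ Dinc`, `0 < r ≤ 1` ⇒ `0 ≤ Qtot` and `Qtot·(r/2)² ≤ Dinc·(1 + C₂r²·(ρ·QH + qb) + 4QH + 2t₀p₀QH)/4`.
[folklore] -/
theorem levNumW_Qtot_le (hr : 0 < r) (hr1 : r ≤ 1) (ht₀ : 0 ≤ t₀) (hp₀ : 0 ≤ p₀) (hτ : τ = t₀ * r ^ 2) (hψ : ψ = p₀ / r ^ 2)
    (hQ'0 : 0 < Q') (hQ'₂ : Q' ≤ QH / r ^ 2) (hQb0 : 0 ≤ Qb) (hQb : Qb ≤ qb / r ^ 2) (hρ : 0 < ρ) (hQ : Q = ρ * Q') (hDinc : 1 ≤ Dinc)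
    (hQro : Qro = C₂r ^ 2 * max Q Qb) (hQtot : Qtot = Dinc * max 1 (max Qro (max (4 * Q') (2 * τ * ψ * Q')))) :
    0 ≤ Qtot ∧ Qtot * (r / 2) ^ 2 ≤ Dinc * (1 + C₂r ^ 2 * (ρ * QH + qb) + 4 * QH + 2 * t₀ * p₀ * QH) / 4 := by
  have hQr' : Q' * r ^ 2 ≤ QH := (le_div_iff₀ (by positivity)).1 hQ'₂
  have hQbr : Qb * r ^ 2 ≤ qb := (le_div_iff₀ (by positivity)).1 hQb
  have hD0 : 0 ≤ Dinc := by linarith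
  have hQ0 : 0 ≤ Q := by rw [hQ]; positivity
  have hQro0 : 0 ≤ Qro := by rw [hQro]; exact mul_nonneg (sq_nonneg _) (le_max_of_le_right hQb0)
  refine ⟨by rw [hQtot]; exact mul_nonneg hD0 (le_trans zero_le_one (le_max_left _ _)), ?_⟩
  have hτψ : 2 * τ * ψ * Q' = 2 * t₀ * p₀ * Q' := by rw [hτ, hψ]; field_simp
  have hm₁ : max Q Qb ≤ Q + Qb := max_le (by linarith) (by linarith)
  have hQro' : Qro * r ^ 2 ≤ C₂r ^ 2 * (ρ * QH + qb) := by
    rw [hQro]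
    calc C₂r ^ 2 * max Q Qb * r ^ 2 ≤ C₂r ^ 2 * (Q + Qb) * r ^ 2 := by gcongr
      _ = C₂r ^ 2 * (ρ * (Q' * r ^ 2) + Qb * r ^ 2) := by rw [hQ]; ring
      _ ≤ C₂r ^ 2 * (ρ * QH + qb) := by gcongr
  have hr2 : r ^ 2 ≤ 1 := pow_le_one₀ hr.le hr1
  have h4 : 0 ≤ 4 * Q' := by positivity
  have h5 : 0 ≤ 2 * τ * ψ * Q' := by rw [hτψ]; positivity
  have h1 : max 1 (max Qro (max (4 * Q') (2 * τ * ψ * Q'))) ≤ 1 + Qro + 4 * Q' + 2 * τ * ψ * Q' :=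
    max_le (by linarith) (max_le (by linarith) (max_le (by linarith) (by linarith)))
  have hm : max 1 (max Qro (max (4 * Q') (2 * τ * ψ * Q'))) * r ^ 2 ≤ 1 + C₂r ^ 2 * (ρ * QH + qb) + 4 * QH + 2 * t₀ * p₀ * QH := by
    calc max 1 (max Qro (max (4 * Q') (2 * τ * ψ * Q'))) * r ^ 2 ≤ (1 + Qro + 4 * Q' + 2 * τ * ψ * Q') * r ^ 2 :=
          mul_le_mul_of_nonneg_right h1 (by positivity)
      _ = r ^ 2 + Qro * r ^ 2 + 4 * (Q' * r ^ 2) + 2 * t₀ * p₀ * (Q' * r ^ 2) := by rw [hτψ]; ring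
      _ ≤ 1 + C₂r ^ 2 * (ρ * QH + qb) + 4 * QH + 2 * t₀ * p₀ * QH := by gcongr
  rw [hQtot]
  calc Dinc * max 1 (max Qro (max (4 * Q') (2 * τ * ψ * Q'))) * (r / 2) ^ 2
      = Dinc * (max 1 (max Qro (max (4 * Q') (2 * τ * ψ * Q'))) * r ^ 2) / 4 := by ring
    _ ≤ Dinc * (1 + C₂r ^ 2 * (ρ * QH + qb) + 4 * QH + 2 * t₀ * p₀ * QH) / 4 := by gcongr

end ReadoutW

/-! ## Monotonicity of the kit rows in the six-leg slot, the blocking conversion, the amplitude bookkeeping -/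

section MonoW

variable {Φ τ ψ σ lam Q' Q A A' ι₁ ι₂ ι₃ ι₃' : ℝ}

/-- **The y-, θ- and close rows are MONOTONE in the six-leg slot `ι₃`** (`0 ≤ ι₃ ≤ ι₃′`, all names nonnegative): each row at `ι₃′` implies the row at `ι₃`
(the close row under the y-row at `ι₃′`). Used to pass from …TowerLevNumericsG's pinned `ι₃ᴳ = WZ³X + A′Q″³` to W10's pinned `ι₃ = x₆(M/β)⁵ ≤ ι₃ᴳ`. [folklore] -/
theorem levNumW_rows_mono (hΦ : 0 ≤ Φ) (hτ : 0 ≤ τ) (hψ : 0 ≤ ψ) (hQ' : 0 ≤ Q') (hA' : 0 ≤ A') (hlam : 0 ≤ lam) (hι₁ : 0 ≤ ι₁) (hι₂ : 0 ≤ ι₂)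
    (hι₃0 : 0 ≤ ι₃) (hι₃ : ι₃ ≤ ι₃') :
    (Φ * (τ * (ι₁ * lam + ι₂ / (2 * Q') + ι₃' / (4 * Q' ^ 2) + A' * Q' / 4)) < 1 →
      Φ * (τ * (ι₁ * lam + ι₂ / (2 * Q') + ι₃ / (4 * Q' ^ 2) + A' * Q' / 4)) < 1) ∧
    (Φ * (exp 1 * τ * (ι₁ * lam) + (exp 1 * τ) ^ 2 * (ι₂ * lam) + (exp 1 * τ) ^ 3 * (ι₃' * lam ^ 2) +
        A' * (exp 1 * τ * Q') * ((exp 1 * τ * lam * Q') ^ 3 / (1 - exp 1 * τ * lam * Q'))) < 1 →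
      Φ * (exp 1 * τ * (ι₁ * lam) + (exp 1 * τ) ^ 2 * (ι₂ * lam) + (exp 1 * τ) ^ 3 * (ι₃ * lam ^ 2) +
        A' * (exp 1 * τ * Q') * ((exp 1 * τ * lam * Q') ^ 3 / (1 - exp 1 * τ * lam * Q'))) < 1) ∧
    (Φ * (τ * (ι₁ * lam + ι₂ / (2 * Q') + ι₃' / (4 * Q' ^ 2) + A' * Q' / 4)) < 1 →
      A' * (4 * Q') ^ 3 * (4 * σ * lam * Q' / (1 - 4 * σ * lam * Q')) +
        exp 1 * ψ * (2 * τ * ψ * Q') ^ 2 * (τ * (ι₁ * lam + ι₂ / (2 * Q') + ι₃' / (4 * Q' ^ 2) + A' * Q' / 4)) *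
          (Φ * (τ * (ι₁ * lam + ι₂ / (2 * Q') + ι₃' / (4 * Q' ^ 2) + A' * Q' / 4)) /
            (1 - Φ * (τ * (ι₁ * lam + ι₂ / (2 * Q') + ι₃' / (4 * Q' ^ 2) + A' * Q' / 4)))) ≤ A * Q ^ 3 →
      A' * (4 * Q') ^ 3 * (4 * σ * lam * Q' / (1 - 4 * σ * lam * Q')) +
        exp 1 * ψ * (2 * τ * ψ * Q') ^ 2 * (τ * (ι₁ * lam + ι₂ / (2 * Q') + ι₃ / (4 * Q' ^ 2) + A' * Q' / 4)) *
          (Φ * (τ * (ι₁ * lam + ι₂ / (2 * Q') + ι₃ / (4 * Q' ^ 2) + A' * Q' / 4)) /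
            (1 - Φ * (τ * (ι₁ * lam + ι₂ / (2 * Q') + ι₃ / (4 * Q' ^ 2) + A' * Q' / 4)))) ≤ A * Q ^ 3) := by
  set S : ℝ := ι₁ * lam + ι₂ / (2 * Q') + ι₃ / (4 * Q' ^ 2) + A' * Q' / 4 with hS
  set S' : ℝ := ι₁ * lam + ι₂ / (2 * Q') + ι₃' / (4 * Q' ^ 2) + A' * Q' / 4 with hS'
  have hS0 : 0 ≤ S := by rw [hS]; positivity
  have hSS : S ≤ S' := by
    have : ι₃ / (4 * Q' ^ 2) ≤ ι₃' / (4 * Q' ^ 2) := div_le_div_of_nonneg_right hι₃ (by positivity)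
    rw [hS, hS']; linarith
  have hy_mono : Φ * (τ * S) ≤ Φ * (τ * S') := by gcongr
  refine ⟨fun h => lt_of_le_of_lt hy_mono h, fun h => lt_of_le_of_lt ?_ h, fun hy' hc => ?_⟩
  · have h3 : (exp 1 * τ) ^ 3 * (ι₃ * lam ^ 2) ≤ (exp 1 * τ) ^ 3 * (ι₃' * lam ^ 2) := by gcongr
    exact mul_le_mul_of_nonneg_left (by linarith) hΦ
  · have hy0 : 0 ≤ Φ * (τ * S) := by positivity
    have hy'1 : Φ * (τ * S') < 1 := hy'
    have hy1 : Φ * (τ * S) < 1 := lt_of_le_of_lt hy_mono hy'1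
    have hratio : Φ * (τ * S) / (1 - Φ * (τ * S)) ≤ Φ * (τ * S') / (1 - Φ * (τ * S')) := by
      rw [div_le_div_iff₀ (by linarith) (by linarith)]; nlinarith
    have hratio0 : 0 ≤ Φ * (τ * S) / (1 - Φ * (τ * S)) := div_nonneg hy0 (by linarith)
    have hprod : τ * S * (Φ * (τ * S) / (1 - Φ * (τ * S))) ≤ τ * S' * (Φ * (τ * S') / (1 - Φ * (τ * S'))) :=
      mul_le_mul (by gcongr) hratio hratio0 (mul_nonneg hτ (hS0.trans hSS))
    have h2 : exp 1 * ψ * (2 * τ * ψ * Q') ^ 2 * (τ * S) * (Φ * (τ * S) / (1 - Φ * (τ * S))) ≤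
        exp 1 * ψ * (2 * τ * ψ * Q') ^ 2 * (τ * S') * (Φ * (τ * S') / (1 - Φ * (τ * S'))) := by
      have h0 : 0 ≤ exp 1 * ψ * (2 * τ * ψ * Q') ^ 2 := by positivity
      calc exp 1 * ψ * (2 * τ * ψ * Q') ^ 2 * (τ * S) * (Φ * (τ * S) / (1 - Φ * (τ * S)))
          = exp 1 * ψ * (2 * τ * ψ * Q') ^ 2 * (τ * S * (Φ * (τ * S) / (1 - Φ * (τ * S)))) := by ring
        _ ≤ exp 1 * ψ * (2 * τ * ψ * Q') ^ 2 * (τ * S' * (Φ * (τ * S') / (1 - Φ * (τ * S')))) := mul_le_mul_of_nonneg_left hprod h0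
        _ = exp 1 * ψ * (2 * τ * ψ * Q') ^ 2 * (τ * S') * (Φ * (τ * S') / (1 - Φ * (τ * S'))) := by ring
    linarith

end MonoW

section BlockAmpW

variable {Z τ ψ κQ pZ pρ C₂ W κA ab QL QH K K₁ K₂ BfW Bf yP i₂ x₆ : ℝ} {d : ℕ}

/-- **The blocking row from the block length**: `Z = pZ`, `max 4 (2τψ) = pρ`, `κ_Q = C₂²·(2^{d−1})⁻¹` and `max 1 pZ · C₂² · pρ ≤ 2^{d−1}` give NumericsG's
`max 1 Z · κ_Q · max 4 (2τψ) ≤ 1`. [folklore] -/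
theorem levNumW_block (hZ : Z = pZ) (hρ : max 4 (2 * τ * ψ) = pρ) (hκQ : κQ = C₂ ^ 2 * ((2 : ℝ) ^ (d - 1))⁻¹)
    (hblock : max 1 pZ * C₂ ^ 2 * pρ ≤ (2 : ℝ) ^ (d - 1)) : max 1 Z * κQ * max 4 (2 * τ * ψ) ≤ 1 := by
  have h2 : (0 : ℝ) < (2 : ℝ) ^ (d - 1) := by positivity
  rw [hZ, hρ, hκQ]
  calc max 1 pZ * (C₂ ^ 2 * ((2 : ℝ) ^ (d - 1))⁻¹) * pρ = max 1 pZ * C₂ ^ 2 * pρ / (2 : ℝ) ^ (d - 1) := by field_simp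
    _ ≤ 1 := (div_le_one h2).2 hblock

/-- **The amplitude bookkeeping**: with `K = max K₁ K₂` (`K₁ ≥ 0`), the base floor `QL = 1 + (i₂ + x₆)·K`, the threshold `BfW = (W + κ_A)·ab·QH·K ≤ Bf`, `1 ≤ Bf`
(`i₂, x₆, (W + κ_A)·ab·QH ≥ 0`) and `yP = i₂/(2QL) + x₆/(4QL²) + (W + κ_A)·ab·QH/(2Bf²)`: `0 ≤ yP`, `yP·K₁ ≤ 1` and `yP·K₂ ≤ 1`. [folklore] -/
theorem levNumW_yP_small (hK₁ : 0 ≤ K₁) (hK : K = max K₁ K₂) (hi₂ : 0 ≤ i₂) (hx₆ : 0 ≤ x₆) (hWκ : 0 ≤ (W + κA) * ab * QH)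
    (hQL : QL = 1 + (i₂ + x₆) * K) (hBfW : BfW = (W + κA) * ab * QH * K) (hBf : BfW ≤ Bf) (hBf1 : 1 ≤ Bf)
    (hyP : yP = i₂ / (2 * QL) + x₆ / (4 * QL ^ 2) + (W + κA) * ab * QH / (2 * Bf ^ 2)) : 0 ≤ yP ∧ yP * K₁ ≤ 1 ∧ yP * K₂ ≤ 1 := by
  have hK0 : 0 ≤ K := by rw [hK]; exact le_max_of_le_left hK₁
  have hQL1 : 1 ≤ QL := by rw [hQL]; nlinarith [mul_nonneg (add_nonneg hi₂ hx₆) hK0]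
  have hQL0 : 0 < QL := by linarith
  have hBf0 : 0 < Bf := by linarith
  have hyP0 : 0 ≤ yP := by rw [hyP]; positivity
  -- `yP·K ≤ 1`
  have hmain : yP * K ≤ 1 := by
    have h1 : x₆ / (4 * QL ^ 2) ≤ x₆ / (2 * QL) := by
      refine div_le_div_of_nonneg_left hx₆ (by positivity) ?_
      nlinarith
    have h2 : (i₂ / (2 * QL) + x₆ / (2 * QL)) * K ≤ 1 / 2 := by
      rw [← add_div, div_mul_eq_mul_div, div_le_iff₀ (by positivity), hQL]
      nlinarith [mul_nonneg (add_nonneg hi₂ hx₆) hK0]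
    have h3 : (W + κA) * ab * QH / (2 * Bf ^ 2) * K ≤ 1 / 2 := by
      have hBB : Bf ≤ Bf ^ 2 := by nlinarith
      have h4 : (W + κA) * ab * QH * K ≤ Bf ^ 2 := by rw [← hBfW]; exact hBf.trans hBB
      rw [div_mul_eq_mul_div, div_le_iff₀ (by positivity)]
      nlinarith
    calc yP * K = (i₂ / (2 * QL) + x₆ / (4 * QL ^ 2)) * K + (W + κA) * ab * QH / (2 * Bf ^ 2) * K := by rw [hyP]; ring
      _ ≤ (i₂ / (2 * QL) + x₆ / (2 * QL)) * K + (W + κA) * ab * QH / (2 * Bf ^ 2) * K := by gcongr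
      _ ≤ 1 / 2 + 1 / 2 := add_le_add h2 h3
      _ = 1 := by norm_num
  have hK₁K : K₁ ≤ K := by rw [hK]; exact le_max_left _ _
  have hK₂K : K₂ ≤ K := by rw [hK]; exact le_max_right _ _
  exact ⟨hyP0, (mul_le_mul_of_nonneg_left hK₁K hyP0).trans hmain, (mul_le_mul_of_nonneg_left hK₂K hyP0).trans hmain⟩

end BlockAmpW

end Summit.HubbardSuperconductivity.HubbardSuperconductivity.Theorems.EngineV8

end
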